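import Mathlib
import Summits.Langlands.Langlands.Theses.TorsionKudlaMillsonWindow

/-!
# Piece `CosetFTraceTwist` (stmt-Langlands-18921) of the decomposition of `FTraceCongruenceGeneration` (stmt-Langlands-13533) — birth skeleton

Two stubs cut the coset twist at its natural joint:
* `stub_cosetRepresentation` — REPRESENTATION (genus / spinor genus of the indefinite ternary lattices
  `gO₀ ∩ B₀⁰`): on one congruence coset, off finitely many square classes, SOME twist `u₀ ∈ O₀¹` with
  `tr(γu₀) ∈ F` exists, and `γ` is non-degenerate there (`γ⁺ ≠ 0`, `g(γ)` non-scalar);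
* `stub_traceAvoidance` — PROPAGATION (Zariski density of `(O₀ ∩ gO₀g⁻¹)¹` in `B₀¹`, Borel): from one
  twist of a non-degenerate `γ` one gets twists with `re u`, `re (γu)` outside any finite `T`.
`CosetFTraceTwist_of` composes them (no `sorry`).
-/

set_option linter.dupNamespace false

namespace Summit.Langlands.Langlands.Cruxes.CosetFTraceTwist.Birth

open Summit.Langlands.Langlands.Theses.TorsionKudlaMillsonWindow
open scoped Quaternion

/-- STUB (hardest): representation on a coset with non-degeneracy. [folklore] -/
theorem stub_cosetRepresentation :
    ∀ (F K : Type) [Field F] [NumberField F] [Field K] [NumberField K] [Algebra F K] (σ : K ≃ₐ[F] K) (a b : NumberField.RingOfIntegers F), NumberField.IsTotallyReal F → Module.finrank F K = 2 → σ ≠ 1 → NumberField.InfinitePlace.nrComplexPlaces K = 1 → a ≠ 0 → b ≠ 0 → (∀ φ : K →+* ℂ, (starRingEnd ℂ).comp φ = φ → (φ (algebraMap F K a)).re < 0 ∧ (φ (algebraMap F K b)).re < 0) → (∀ φ : K →+* ℂ, (starRingEnd ℂ).comp φ ≠ φ → 0 < (φ (algebraMap F K a)).re ∨ 0 < (φ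 (algebraMap F K b)).re) → let a' : K := algebraMap F K a; let b' : K := algebraMap F K b; (∀ y : QuaternionAlgebra K a' 0 b', y * star y = 0 → y = 0) → let IsInt : QuaternionAlgebra K a' 0 b' → Prop := fun x => ∀ i : Fin 4, QuaternionAlgebra.equivTuple a' 0 b' x i ∈ Set.range (algebraMap (NumberField.RingOfIntegers K) K); let IsG : (QuaternionAlgebra K a' 0 b')ˣ → Prop := fun u => IsInt (u : QuaternionAlgebra K a' 0 b') ∧ IsInt ((u⁻¹ : (QuaternionAlgebra K a' 0 b')ˣ) : QuaternionAlgebra K a' 0 b'); let G1 : (QuaternionAlgebra K a' 0 b')ˣ → Prop := fun u => IsG u ∧ (u : QuaternionAlgebra K a' 0 b') * star (u : QuaternionAlgebra K a' 0 b') = 1; let sB : QuaternionAlgebra K a' 0 b' → QuaternionAlgebra K a' 0 b' := fun y => ⟨σ y.re, σ y.imI, σ y.imJ, σ y.imK⟩; let Good : ℕ → (QuaternionAlgebra K a' 0 b')ˣ → Finset F → (QuaternionAlgebra K a' 0 b')ˣ → Prop := fun M x C γ => G1 γ ∧ (∀ i : Fin 4, QuaternionAlgebra.equivTuple a' 0 b'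 ((γ : QuaternionAlgebra K a' 0 b') - (x : QuaternionAlgebra K a' 0 b')) i ∈ Set.range (fun y : NumberField.RingOfIntegers K => (((M : NumberField.RingOfIntegers K) * y : NumberField.RingOfIntegers K) : K))) ∧ ∀ c ∈ C, ∀ f : F, (((γ : QuaternionAlgebra K a' 0 b') - sB (γ : QuaternionAlgebra K a' 0 b')) * star ((γ : QuaternionAlgebra K a' 0 b') - sB (γ : QuaternionAlgebra K a' 0 b'))).re ≠ algebraMap F K (c * f ^ 2); ∃ (C : Finset F) (M : ℕ) (x : (QuaternionAlgebra K a' 0 b')ˣ), 0 < M ∧ G1 x ∧ ∀ γ, Good M x C γ → ((γ : QuaternionAlgebra K a' 0 b') + sB (γ : QuaternionAlgebra K a' 0 b') ≠ 0 ∧ ∃ i : Fin 4, i ≠ 0 ∧ QuaternionAlgebra.equivTuple a' 0 b' ((γ : QuaternionAlgebra K a' 0 b') - sB (γ : QuaternionAlgebra K a' 0 b')) i ≠ 0) ∧ ∃ u₀ : (QuaternionAlgebra K a' 0 b')ˣ, G1 u₀ ∧ (∀ i : Fin 4, σ (QuaternionAlgebra.equivTuple a' 0 b' (u₀ : QuaternionAlgebra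 K a' 0 b') i) = QuaternionAlgebra.equivTuple a' 0 b' (u₀ : QuaternionAlgebra K a' 0 b') i) ∧ σ ((γ * u₀ : (QuaternionAlgebra K a' 0 b')ˣ) : QuaternionAlgebra K a' 0 b').re = ((γ * u₀ : (QuaternionAlgebra K a' 0 b')ˣ) : QuaternionAlgebra K a' 0 b').re := by
  sorry

/-- STUB: trace avoidance by Zariski density of an arithmetic Fuchsian group. [folklore] -/
theorem stub_traceAvoidance :
    ∀ (F K : Type) [Field F] [NumberField F] [Field K] [NumberField K] [Algebra F K] (σ : K ≃ₐ[F] K) (a b : NumberField.RingOfIntegers F), NumberField.IsTotallyReal F → Module.finrank F K = 2 → σ ≠ 1 → NumberField.InfinitePlace.nrComplexPlaces K = 1 → a ≠ 0 → b ≠ 0 → (∀ φ : K →+* ℂ, (starRingEnd ℂ).comp φ = φ → (φ (algebraMap F K a)).re < 0 ∧ (φ (algebraMap F K b)).re < 0) → (∀ φ : K →+* ℂ, (starRingEnd ℂ).comp φ ≠ φ → 0 < (φ (algebraMap F K a)).re ∨ 0 < (φ (algebraMap F K b)).re) → let a' : K := algebraMap F K a; let b' : K := algebraMap F K b; (∀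 y : QuaternionAlgebra K a' 0 b', y * star y = 0 → y = 0) → let IsInt : QuaternionAlgebra K a' 0 b' → Prop := fun x => ∀ i : Fin 4, QuaternionAlgebra.equivTuple a' 0 b' x i ∈ Set.range (algebraMap (NumberField.RingOfIntegers K) K); let IsG : (QuaternionAlgebra K a' 0 b')ˣ → Prop := fun u => IsInt (u : QuaternionAlgebra K a' 0 b') ∧ IsInt ((u⁻¹ : (QuaternionAlgebra K a' 0 b')ˣ) : QuaternionAlgebra K a' 0 b'); let G1 : (QuaternionAlgebra K a' 0 b')ˣ → Prop := fun u => IsG u ∧ (u : QuaternionAlgebra K a' 0 b') * star (u : QuaternionAlgebra K a' 0 b') = 1; let sB : QuaternionAlgebra K a' 0 b' → QuaternionAlgebra K a' 0 b' := fun y => ⟨σ y.re, σ y.imI, σ y.imJ, σ y.imK⟩; ∀ γ : (QuaternionAlgebra K a' 0 b')ˣ, G1 γ → (γ : QuaternionAlgebra K a' 0 b') + sB (γ : QuaternionAlgebra K a' 0 b') ≠ 0 → (∃ i : Fin 4, i ≠ 0 ∧ QuaternionAlgebra.equivTuple a' 0 b' ((γ : QuaternionAlgebra K a' 0 b') - sB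 (γ : QuaternionAlgebra K a' 0 b')) i ≠ 0) → ∀ u₀ : (QuaternionAlgebra K a' 0 b')ˣ, G1 u₀ ∧ (∀ i : Fin 4, σ (QuaternionAlgebra.equivTuple a' 0 b' (u₀ : QuaternionAlgebra K a' 0 b') i) = QuaternionAlgebra.equivTuple a' 0 b' (u₀ : QuaternionAlgebra K a' 0 b') i) → σ ((γ * u₀ : (QuaternionAlgebra K a' 0 b')ˣ) : QuaternionAlgebra K a' 0 b').re = ((γ * u₀ : (QuaternionAlgebra K a' 0 b')ˣ) : QuaternionAlgebra K a' 0 b').re → ∀ T : Finset K, ∃ u : (QuaternionAlgebra K a' 0 b')ˣ, G1 u ∧ (∀ i : Fin 4, σ (QuaternionAlgebra.equivTuple a' 0 b' (u : QuaternionAlgebra K a' 0 b') i) = QuaternionAlgebra.equivTuple a' 0 b' (u : QuaternionAlgebra K a' 0 b') i) ∧ σ ((γ * u : (QuaternionAlgebra K a' 0 b')ˣ) : QuaternionAlgebra K a' 0 b').re = ((γ * u : (QuaternionAlgebra K a' 0 b')ˣ) : QuaternionAlgebra K a' 0 b').re ∧ (u : QuaternionAlgebra K a' 0 b').re ∉ T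 ∧ ((γ * u : (QuaternionAlgebra K a' 0 b')ˣ) : QuaternionAlgebra K a' 0 b').re ∉ T := by
  sorry

/-! ## Name-keyed aliases of the two stub statements — the hypotheses of `CosetFTraceTwist_of`

The native skeleton audit (`#h21_check_skeleton`, run by `ledger skeleton check`) admits a hypothesis of the
composing theorem only if its head constant is a registered obligation or is NAMED like a declared stub;
`__Registered.stub_X` is the statement of `stub_X` verbatim (same source text) under the stub's short name
(device of `AnomalousDissipation/…/Cruxes/CyclicWindLineLoud/Lines/birth.lean`; the gate-reserved `@[stub]`
attribute is not written by a planner). -/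
namespace __Registered

/-- Alias of the statement of `stub_cosetRepresentation`, keyed by the stub name. -/
abbrev stub_cosetRepresentation : Prop :=
  ∀ (F K : Type) [Field F] [NumberField F] [Field K] [NumberField K] [Algebra F K] (σ : K ≃ₐ[F] K) (a b : NumberField.RingOfIntegers F), NumberField.IsTotallyReal F → Module.finrank F K = 2 → σ ≠ 1 → NumberField.InfinitePlace.nrComplexPlaces K = 1 → a ≠ 0 → b ≠ 0 → (∀ φ : K →+* ℂ, (starRingEnd ℂ).comp φ = φ → (φ (algebraMap F K a)).re < 0 ∧ (φ (algebraMap F K b)).re < 0) → (∀ φ : K →+* ℂ, (starRingEnd ℂ).comp φ ≠ φ → 0 < (φ (algebraMap F K a)).re ∨ 0 < (φ (algebraMap F K b)).re) → let a' : K := algebraMap F K a; let b' : K := algebraMap F K b; (∀ y : QuaternionAlgebra K a' 0 b', y * star y = 0 → y = 0) → let IsInt : QuaternionAlgebra K a' 0 b' → Prop := fun x => ∀ i : Fin 4, QuaternionAlgebra.equivTuple a' 0 b' x i ∈ Set.range (algebraMap (NumberField.RingOfIntegers K) K); let IsG : (QuaternionAlgebra K a' 0 b')ˣ → Prop := fun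 u => IsInt (u : QuaternionAlgebra K a' 0 b') ∧ IsInt ((u⁻¹ : (QuaternionAlgebra K a' 0 b')ˣ) : QuaternionAlgebra K a' 0 b'); let G1 : (QuaternionAlgebra K a' 0 b')ˣ → Prop := fun u => IsG u ∧ (u : QuaternionAlgebra K a' 0 b') * star (u : QuaternionAlgebra K a' 0 b') = 1; let sB : QuaternionAlgebra K a' 0 b' → QuaternionAlgebra K a' 0 b' := fun y => ⟨σ y.re, σ y.imI, σ y.imJ, σ y.imK⟩; let Good : ℕ → (QuaternionAlgebra K a' 0 b')ˣ → Finset F → (QuaternionAlgebra K a' 0 b')ˣ → Prop := fun M x C γ => G1 γ ∧ (∀ i : Fin 4, QuaternionAlgebra.equivTuple a' 0 b' ((γ : QuaternionAlgebra K a' 0 b') - (x : QuaternionAlgebra K a' 0 b')) i ∈ Set.range (fun y : NumberField.RingOfIntegers K => (((M : NumberField.RingOfIntegers K) * y : NumberField.RingOfIntegers K) : K))) ∧ ∀ c ∈ C, ∀ f : F, (((γ : QuaternionAlgebra K a' 0 b') - sB (γ : QuaternionAlgebra K a' 0 b')) * star ((γ : QuaternionAlgebra K a' 0 b') - sB (γ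 : QuaternionAlgebra K a' 0 b'))).re ≠ algebraMap F K (c * f ^ 2); ∃ (C : Finset F) (M : ℕ) (x : (QuaternionAlgebra K a' 0 b')ˣ), 0 < M ∧ G1 x ∧ ∀ γ, Good M x C γ → ((γ : QuaternionAlgebra K a' 0 b') + sB (γ : QuaternionAlgebra K a' 0 b') ≠ 0 ∧ ∃ i : Fin 4, i ≠ 0 ∧ QuaternionAlgebra.equivTuple a' 0 b' ((γ : QuaternionAlgebra K a' 0 b') - sB (γ : QuaternionAlgebra K a' 0 b')) i ≠ 0) ∧ ∃ u₀ : (QuaternionAlgebra K a' 0 b')ˣ, G1 u₀ ∧ (∀ i : Fin 4, σ (QuaternionAlgebra.equivTuple a' 0 b' (u₀ : QuaternionAlgebra K a' 0 b') i) = QuaternionAlgebra.equivTuple a' 0 b' (u₀ : QuaternionAlgebra K a' 0 b') i) ∧ σ ((γ * u₀ : (QuaternionAlgebra K a' 0 b')ˣ) : QuaternionAlgebra K a' 0 b').re = ((γ * u₀ : (QuaternionAlgebra K a' 0 b')ˣ) : QuaternionAlgebra K a' 0 b').re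

/-- Alias of the statement of `stub_traceAvoidance`, keyed by the stub name. -/
abbrev stub_traceAvoidance : Prop :=
  ∀ (F K : Type) [Field F] [NumberField F] [Field K] [NumberField K] [Algebra F K] (σ : K ≃ₐ[F] K) (a b : NumberField.RingOfIntegers F), NumberField.IsTotallyReal F → Module.finrank F K = 2 → σ ≠ 1 → NumberField.InfinitePlace.nrComplexPlaces K = 1 → a ≠ 0 → b ≠ 0 → (∀ φ : K →+* ℂ, (starRingEnd ℂ).comp φ = φ → (φ (algebraMap F K a)).re < 0 ∧ (φ (algebraMap F K b)).re < 0) → (∀ φ : K →+* ℂ, (starRingEnd ℂ).comp φ ≠ φ → 0 < (φ (algebraMap F K a)).re ∨ 0 < (φ (algebraMap F K b)).re) → let a' : K := algebraMap F K a; let b' : K := algebraMap F K b; (∀ y : QuaternionAlgebra K a' 0 b', y * star y = 0 → y = 0) → let IsInt : QuaternionAlgebra K a' 0 b' → Prop := fun x => ∀ i : Fin 4, QuaternionAlgebra.equivTuple a' 0 b' x i ∈ Set.range (algebraMap (NumberField.RingOfIntegers K) K); let IsG : (QuaternionAlgebra K a' 0 b')ˣ → Prop := fun u => IsInt (u : QuaternionAlgebra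 K a' 0 b') ∧ IsInt ((u⁻¹ : (QuaternionAlgebra K a' 0 b')ˣ) : QuaternionAlgebra K a' 0 b'); let G1 : (QuaternionAlgebra K a' 0 b')ˣ → Prop := fun u => IsG u ∧ (u : QuaternionAlgebra K a' 0 b') * star (u : QuaternionAlgebra K a' 0 b') = 1; let sB : QuaternionAlgebra K a' 0 b' → QuaternionAlgebra K a' 0 b' := fun y => ⟨σ y.re, σ y.imI, σ y.imJ, σ y.imK⟩; ∀ γ : (QuaternionAlgebra K a' 0 b')ˣ, G1 γ → (γ : QuaternionAlgebra K a' 0 b') + sB (γ : QuaternionAlgebra K a' 0 b') ≠ 0 → (∃ i : Fin 4, i ≠ 0 ∧ QuaternionAlgebra.equivTuple a' 0 b' ((γ : QuaternionAlgebra K a' 0 b') - sB (γ : QuaternionAlgebra K a' 0 b')) i ≠ 0) → ∀ u₀ : (QuaternionAlgebra K a' 0 b')ˣ, G1 u₀ ∧ (∀ i : Fin 4, σ (QuaternionAlgebra.equivTuple a' 0 b' (u₀ : QuaternionAlgebra K a' 0 b') i) = QuaternionAlgebra.equivTuple a' 0 b' (u₀ : QuaternionAlgebra K a' 0 b') i)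 → σ ((γ * u₀ : (QuaternionAlgebra K a' 0 b')ˣ) : QuaternionAlgebra K a' 0 b').re = ((γ * u₀ : (QuaternionAlgebra K a' 0 b')ˣ) : QuaternionAlgebra K a' 0 b').re → ∀ T : Finset K, ∃ u : (QuaternionAlgebra K a' 0 b')ˣ, G1 u ∧ (∀ i : Fin 4, σ (QuaternionAlgebra.equivTuple a' 0 b' (u : QuaternionAlgebra K a' 0 b') i) = QuaternionAlgebra.equivTuple a' 0 b' (u : QuaternionAlgebra K a' 0 b') i) ∧ σ ((γ * u : (QuaternionAlgebra K a' 0 b')ˣ) : QuaternionAlgebra K a' 0 b').re = ((γ * u : (QuaternionAlgebra K a' 0 b')ˣ) : QuaternionAlgebra K a' 0 b').re ∧ (u : QuaternionAlgebra K a' 0 b').re ∉ T ∧ ((γ * u : (QuaternionAlgebra K a' 0 b')ˣ) : QuaternionAlgebra K a' 0 b').re ∉ T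

end __Registered

/-- **Composition** (kernel-checked, no `sorry` of its own): the two stub statements (as the name-keyed aliases
`__Registered.stub_*`) imply the piece `CosetFTraceTwist` BY NAME. [folklore] -/
theorem CosetFTraceTwist_of :
    __Registered.stub_cosetRepresentation → __Registered.stub_traceAvoidance →
      Summit.Langlands.Langlands.Theses.TorsionKudlaMillsonWindow.CosetFTraceTwist := by
  intro hA hB
  dsimp only [__Registered.stub_cosetRepresentation, __Registered.stub_traceAvoidance] at hA hB
  intro F K _ _ _ _ _ σ a b hF hK2 hσ hcx ha hb hneg hpos a' b' hdiv IsInt IsG G1 sB Good T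
  obtain ⟨C, M, x, hM, hx, hrep⟩ := hA F K σ a b hF hK2 hσ hcx ha hb hneg hpos hdiv
  have hB' := hB F K σ a b hF hK2 hσ hcx ha hb hneg hpos hdiv
  refine ⟨C, M, x, hM, hx, fun γ hγ => ?_⟩
  obtain ⟨⟨hnd1, hnd2⟩, u₀, hu₀, hco₀, htr₀⟩ := hrep γ hγ
  obtain ⟨hγ1, -, -⟩ := hγ
  obtain ⟨u, hu, hco, htr, huT, hγuT⟩ := hB' γ hγ1 hnd1 hnd2 u₀ ⟨hu₀, hco₀⟩ htr₀ T
  exact ⟨u, hu, hco, htr, huT, hγuT⟩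

/-- WIRING CHECK: the two sorried stubs compose to a closed term of the piece's type (modulo their `sorry`s);
an `example`, so no pre-composed constant of type `CosetFTraceTwist` enters an importing environment. -/
example : Summit.Langlands.Langlands.Theses.TorsionKudlaMillsonWindow.CosetFTraceTwist :=
  CosetFTraceTwist_of stub_cosetRepresentation stub_traceAvoidance

end Summit.Langlands.Langlands.Cruxes.CosetFTraceTwist.Birth
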